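import Summits.BirchSwinnertonDyer.BirchSwinnertonDyer.Theorems.KolyvaginDepthDoorDepthTableRowKitPrint
import Summits.BirchSwinnertonDyer.BirchSwinnertonDyer.Theorems.KolyvaginDepthDoorDepthTableRowsOfPrint2
import Summits.BirchSwinnertonDyer.BirchSwinnertonDyer.Theorems.KolyvaginDepthDoorDepthTableRowsOfPrint3
import Summits.BirchSwinnertonDyer.BirchSwinnertonDyer.Theorems.KolyvaginDepthDoorDepthTableRowsOfPrint4
import HarnessLib

/-!
# Route `KolyvaginDepthDoor` — DEPTH-TABLE rows `563a1` `(5, -8, 199)`, `571b1` `(5, -8, 29)`, `643a1` `(5, -8, 149)`, `655a1` `(7, -51, 83)`, `681c1` `(5, -83, 19)`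
# ON PRINT-STANDARD INPUTS: no McCallum leaf, no structure theorem, no twist point, no system — the bit at
# ANY datum, (γ) [Gross 1991 Prop. 3.7 (2)] the only named input (crux `KolyvaginDepthSupply`,
# stmt-BirchSwinnertonDyer-21765) — part 2 of 4

Helper file (`--supports stmt-BirchSwinnertonDyer-21765 --as helper`); it closes nothing and BSD is
not proved by it.

g7's rows `C<label>.depthRow_<p>_neg<D>_<ℓ>_ofDatum` (files `…DepthTableRowsNoTwistOfDatum*`) read each row
off the kit OF A DATUM modulo FIVE named McCallum / Gross leaves (`h54 h43 h44 h53 h22`). This file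
re-issues the same rows over the kit ON PRINT-STANDARD INPUTS `depthRow_print_of_datum_of_intModel_certificate`
(file `…DepthTableRowKitPrint`): the sign law (Gross 5.4), McCallum's Lemma 5.3 and Prop. 2.2 are now
tree THEOREMS at level `p` (`…LeafSign`, `…LeafEigenLine`, `…LeafReciprocity`); Lemma 4.3 is PROVED on
the Kodaira–Néron cell (`…LeafLocal`, x11b3's ENDs), and the (KN_p) side condition of each row is
CERTIFIED IN THE KERNEL from the discriminant of its integer model (a `decide`-able table); Prop. 4.4
comes from the ONE remaining named input (γ) = `GrossLMS1991.prop37_2_frobeniusCongruence` (Gross 1991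
Prop. 3.7 (2), cite-only) through `JET.prop44_of_frobeniusCongruence`. Each row
`C<label>.depthRow_<p>_neg<D>_<ℓ>_print` takes ANY single datum `d : KolyvaginHeegnerData Dt β ι ℓ`
and its bit and concludes `corank_{ℤ_p} Ш(E)[p^∞] = 0`, `rank_ℤ E(ℚ) = 2`, `rank_ℤ E^{(D)}(ℚ) ≤ 1`,
`E(ℚ)[p] = 0`, `Ш(E/ℚ)[p] = 0`, `#Sel^(p)(E/ℚ) = p²`. CONDITIONAL on (γ) and the bit;
per-curve; BSD is not proved by it.
-/

set_option linter.dupNamespace false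

noncomputable section

open scoped Classical NumberField

namespace Summit.BirchSwinnertonDyer.BirchSwinnertonDyer.Theorems.KolyvaginDepthDoor

open Literature.NumberTheory.EllipticCurves Literature.NumberTheory.EllipticCurves.ModularForms
  Literature.NumberTheory.EllipticCurves.McCallum1991 WeierstrassCurve
open Summit.BirchSwinnertonDyer.BirchSwinnertonDyer.Rank2Observatory
open Summit.BirchSwinnertonDyer.BirchSwinnertonDyer.Rank1Residual

namespace C563a1

/-- **DEPTH-TABLE ROW`563a1`, `(p, d_K, ℓ) = (5, -8, 199)`, ON PRINT-STANDARD INPUTS — no McCallum leaf,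
no structure theorem, no twist point, no system (bit at ANY datum).** For `E = 563a1`, ANY imaginary
quadratic `K` with `d_K = -8`, any frame `(Dt, β, ι)` and ANY single Kolyvagin–Heegner datum `d` of
conductor `199`, granted the ONE Literature fact (γ) = `GrossLMS1991.prop37_2_frobeniusCongruence`
(Gross 1991 Prop. 3.7 (2), the Eichler–Shimura congruence for Heegner points; cite-only): IF
`d.kolyvaginClass _ 1 ≠ 0` (the row's bit), THEN `corank_{ℤ_5} Ш(E)[5^∞] = 0`, `rank_ℤ E(ℚ) = 2`,
`rank_ℤ E^{(-8)}(ℚ) ≤ 1`, `E(ℚ)[5] = 0`, `Ш(E/ℚ)[5] = 0` and `#Sel^(5)(E/ℚ) = 5²` — the twin of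
`C563a1.depthRow_5_neg8_199_ofDatum` with its FIVE named McCallum / Gross leaves (`h54 h43 h44 h53
h22`) DELETED: the sign law, Lemma 5.3 and Prop. 2.2 are tree theorems (`…LeafSign`,
`…LeafEigenLine`, `…LeafReciprocity`), Lemma 4.3 is proved on the Kodaira–Néron cell / taken from F1
(`…LeafLocal`), Prop. 4.4 comes from (γ) (`JET.prop44_of_frobeniusCongruence`); the Kodaira–Néron
side condition (KN_5) `5 ∤ ord_v(Δ_min)` at the multiplicative places is CERTIFIED IN THE KERNEL
from `Δ(E₀) = -563` (`decide`-able table of `depthRow_print_of_datum_of_intModel_certificate`), the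
additive clause is void (`5 ≠ 3`). Every other side condition is a kernel theorem of the tree (g2–g7
certificates). CONDITIONAL on (γ) and the bit; per-curve; BSD is not proved by it. [cite:
Kolyvagin1991MathAnn, Thm. 2.3] [cite: GrossLMS1991, Prop. 3.7 (2), §5 (5.1), Prop. 6.2 (1)] [cite:
McCallumLMS1991, §§2–5] [cite: JetchevLauterStein2009, §3.6 (arXiv:0707.0032)] -/
theorem depthRow_5_neg8_199_print
    (h372 : GrossLMS1991.prop37_2_frobeniusCongruence)
    (K : Type) [Field K] [NumberField K] (hK : IsImaginaryQuadratic K)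
    (hD : NumberField.discr K = -8) :
    haveI := isElliptic_c563a1;
    haveI := isGloballyMinimal_c563a1;
    haveI : NeZero (((⟨1, 1, 1, -15, 16⟩ : WeierstrassCurve ℤ).map (Int.castRingHom ℚ)).conductorNorm ℤ) :=
      neZero_conductorNorm_of_isElliptic _;
    ∀ (Dt : ModularParametrizationData ((⟨1, 1, 1, -15, 16⟩ : WeierstrassCurve ℤ).map (Int.castRingHom ℚ))
        (((⟨1, 1, 1, -15, 16⟩ : WeierstrassCurve ℤ).map (Int.castRingHom ℚ)).conductorNorm ℤ)) (β : ℤ)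
      (ι : K →+* ℂ) (d : KolyvaginHeegnerData Dt β ι 199),
    d.kolyvaginClass (p := 5) (by norm_num) 1 ≠ 0 →
    ((⟨1, 1, 1, -15, 16⟩ : WeierstrassCurve ℤ).map (Int.castRingHom ℚ)).shaCorank 5 = 0 ∧
      ((⟨1, 1, 1, -15, 16⟩ : WeierstrassCurve ℤ).map (Int.castRingHom ℚ)).mordellWeilRank = 2 ∧
      (((⟨1, 1, 1, -15, 16⟩ : WeierstrassCurve ℤ).map (Int.castRingHom ℚ)).quadraticTwist
        ((-8 : ℤ) : ℚ)).mordellWeilRank ≤ 1 ∧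
      (∀ P : ((⟨1, 1, 1, -15, 16⟩ : WeierstrassCurve ℤ).map (Int.castRingHom ℚ)).toAffine.Point,
        5 • P = 0 → P = 0) ∧
      (∀ x ∈ ((⟨1, 1, 1, -15, 16⟩ : WeierstrassCurve ℤ).map (Int.castRingHom ℚ)).sha, 5 • x = 0 → x = 0) ∧
      Nat.card ↥(selmerGroup ((⟨1, 1, 1, -15, 16⟩ : WeierstrassCurve ℤ).map (Int.castRingHom ℚ))
        ((5 : ℕ) : ℤ)) = 5 ^ 2 := by
  haveI := isElliptic_c563a1
  haveI := isGloballyMinimal_c563a1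
  haveI : NeZero (((⟨1, 1, 1, -15, 16⟩ : WeierstrassCurve ℤ).map (Int.castRingHom ℚ)).conductorNorm ℤ) :=
    neZero_conductorNorm_of_isElliptic _
  intro Dt β ι d hne
  haveI := Fact.mk (by norm_num : Nat.Prime 5)
  exact depthRow_print_of_datum_of_intModel_certificate intModel h372 not_hasCM
    KernelCerts001.C563a1.two_le_rank 5 (by norm_num) hasSurjectiveModNGaloisRep_pow_5 K hK hD
    (by norm_num) (by norm_num) heegner_neg8 199 (by norm_num) (by norm_num) (by decide +kernel)
    (by norm_num) (by norm_num) (by norm_num) (by norm_num) (n := 220) card_199 (by norm_num)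
    (Δ₀ := -563) (by decide +kernel) (B := 11) (by decide +kernel) (by decide +kernel)
    (fun _ _ ↦ Or.inl (by norm_num)) Dt β ι d hne

end C563a1

namespace C571b1

/-- **DEPTH-TABLE ROW`571b1`, `(p, d_K, ℓ) = (5, -8, 29)`, ON PRINT-STANDARD INPUTS — no McCallum leaf,
no structure theorem, no twist point, no system (bit at ANY datum).** For `E = 571b1`, ANY imaginary
quadratic `K` with `d_K = -8`, any frame `(Dt, β, ι)` and ANY single Kolyvagin–Heegner datum `d` of
conductor `29`, granted the ONE Literature fact (γ) = `GrossLMS1991.prop37_2_frobeniusCongruence`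
(Gross 1991 Prop. 3.7 (2), the Eichler–Shimura congruence for Heegner points; cite-only): IF
`d.kolyvaginClass _ 1 ≠ 0` (the row's bit), THEN `corank_{ℤ_5} Ш(E)[5^∞] = 0`, `rank_ℤ E(ℚ) = 2`,
`rank_ℤ E^{(-8)}(ℚ) ≤ 1`, `E(ℚ)[5] = 0`, `Ш(E/ℚ)[5] = 0` and `#Sel^(5)(E/ℚ) = 5²` — the twin of
`C571b1.depthRow_5_neg8_29_ofDatum` with its FIVE named McCallum / Gross leaves (`h54 h43 h44 h53
h22`) DELETED: the sign law, Lemma 5.3 and Prop. 2.2 are tree theorems (`…LeafSign`,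
`…LeafEigenLine`, `…LeafReciprocity`), Lemma 4.3 is proved on the Kodaira–Néron cell / taken from F1
(`…LeafLocal`), Prop. 4.4 comes from (γ) (`JET.prop44_of_frobeniusCongruence`); the Kodaira–Néron
side condition (KN_5) `5 ∤ ord_v(Δ_min)` at the multiplicative places is CERTIFIED IN THE KERNEL
from `Δ(E₀) = -571` (`decide`-able table of `depthRow_print_of_datum_of_intModel_certificate`), the
additive clause is void (`5 ≠ 3`). Every other side condition is a kernel theorem of the tree (g2–g7
certificates). CONDITIONAL on (γ) and the bit; per-curve; BSD is not proved by it. [cite: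
Kolyvagin1991MathAnn, Thm. 2.3] [cite: GrossLMS1991, Prop. 3.7 (2), §5 (5.1), Prop. 6.2 (1)] [cite:
McCallumLMS1991, §§2–5] [cite: JetchevLauterStein2009, §3.6 (arXiv:0707.0032)] -/
theorem depthRow_5_neg8_29_print
    (h372 : GrossLMS1991.prop37_2_frobeniusCongruence)
    (K : Type) [Field K] [NumberField K] (hK : IsImaginaryQuadratic K)
    (hD : NumberField.discr K = -8) :
    haveI := isElliptic_c571b1;
    haveI := isGloballyMinimal_c571b1;
    haveI : NeZero (((⟨0, 1, 1, -4, 2⟩ : WeierstrassCurve ℤ).map (Int.castRingHom ℚ)).conductorNorm ℤ) :=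
      neZero_conductorNorm_of_isElliptic _;
    ∀ (Dt : ModularParametrizationData ((⟨0, 1, 1, -4, 2⟩ : WeierstrassCurve ℤ).map (Int.castRingHom ℚ))
        (((⟨0, 1, 1, -4, 2⟩ : WeierstrassCurve ℤ).map (Int.castRingHom ℚ)).conductorNorm ℤ)) (β : ℤ)
      (ι : K →+* ℂ) (d : KolyvaginHeegnerData Dt β ι 29),
    d.kolyvaginClass (p := 5) (by norm_num) 1 ≠ 0 →
    ((⟨0, 1, 1, -4, 2⟩ : WeierstrassCurve ℤ).map (Int.castRingHom ℚ)).shaCorank 5 = 0 ∧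
      ((⟨0, 1, 1, -4, 2⟩ : WeierstrassCurve ℤ).map (Int.castRingHom ℚ)).mordellWeilRank = 2 ∧
      (((⟨0, 1, 1, -4, 2⟩ : WeierstrassCurve ℤ).map (Int.castRingHom ℚ)).quadraticTwist
        ((-8 : ℤ) : ℚ)).mordellWeilRank ≤ 1 ∧
      (∀ P : ((⟨0, 1, 1, -4, 2⟩ : WeierstrassCurve ℤ).map (Int.castRingHom ℚ)).toAffine.Point,
        5 • P = 0 → P = 0) ∧
      (∀ x ∈ ((⟨0, 1, 1, -4, 2⟩ : WeierstrassCurve ℤ).map (Int.castRingHom ℚ)).sha, 5 • x = 0 → x = 0) ∧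
      Nat.card ↥(selmerGroup ((⟨0, 1, 1, -4, 2⟩ : WeierstrassCurve ℤ).map (Int.castRingHom ℚ))
        ((5 : ℕ) : ℤ)) = 5 ^ 2 := by
  haveI := isElliptic_c571b1
  haveI := isGloballyMinimal_c571b1
  haveI : NeZero (((⟨0, 1, 1, -4, 2⟩ : WeierstrassCurve ℤ).map (Int.castRingHom ℚ)).conductorNorm ℤ) :=
    neZero_conductorNorm_of_isElliptic _
  intro Dt β ι d hne
  haveI := Fact.mk (by norm_num : Nat.Prime 5)
  exact depthRow_print_of_datum_of_intModel_certificate intModel h372 not_hasCM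
    KernelCerts001.C571b1.two_le_rank 5 (by norm_num) hasSurjectiveModNGaloisRep_pow_5 K hK hD
    (by norm_num) (by norm_num) heegner_neg8 29 (by norm_num) (by norm_num) (by decide +kernel)
    (by norm_num) (by norm_num) (by norm_num) (by norm_num) (n := 25) card_29 (by norm_num)
    (Δ₀ := -571) (by decide +kernel) (B := 11) (by decide +kernel) (by decide +kernel)
    (fun _ _ ↦ Or.inl (by norm_num)) Dt β ι d hne

end C571b1

namespace C643a1

/-- **DEPTH-TABLE ROW`643a1`, `(p, d_K, ℓ) = (5, -8, 149)`, ON PRINT-STANDARD INPUTS — no McCallum leaf,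
no structure theorem, no twist point, no system (bit at ANY datum).** For `E = 643a1`, ANY imaginary
quadratic `K` with `d_K = -8`, any frame `(Dt, β, ι)` and ANY single Kolyvagin–Heegner datum `d` of
conductor `149`, granted the ONE Literature fact (γ) = `GrossLMS1991.prop37_2_frobeniusCongruence`
(Gross 1991 Prop. 3.7 (2), the Eichler–Shimura congruence for Heegner points; cite-only): IF
`d.kolyvaginClass _ 1 ≠ 0` (the row's bit), THEN `corank_{ℤ_5} Ш(E)[5^∞] = 0`, `rank_ℤ E(ℚ) = 2`,
`rank_ℤ E^{(-8)}(ℚ) ≤ 1`, `E(ℚ)[5] = 0`, `Ш(E/ℚ)[5] = 0` and `#Sel^(5)(E/ℚ) = 5²` — the twin of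
`C643a1.depthRow_5_neg8_149_ofDatum` with its FIVE named McCallum / Gross leaves (`h54 h43 h44 h53
h22`) DELETED: the sign law, Lemma 5.3 and Prop. 2.2 are tree theorems (`…LeafSign`,
`…LeafEigenLine`, `…LeafReciprocity`), Lemma 4.3 is proved on the Kodaira–Néron cell / taken from F1
(`…LeafLocal`), Prop. 4.4 comes from (γ) (`JET.prop44_of_frobeniusCongruence`); the Kodaira–Néron
side condition (KN_5) `5 ∤ ord_v(Δ_min)` at the multiplicative places is CERTIFIED IN THE KERNEL
from `Δ(E₀) = -643` (`decide`-able table of `depthRow_print_of_datum_of_intModel_certificate`), the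
additive clause is void (`5 ≠ 3`). Every other side condition is a kernel theorem of the tree (g2–g7
certificates). CONDITIONAL on (γ) and the bit; per-curve; BSD is not proved by it. [cite:
Kolyvagin1991MathAnn, Thm. 2.3] [cite: GrossLMS1991, Prop. 3.7 (2), §5 (5.1), Prop. 6.2 (1)] [cite:
McCallumLMS1991, §§2–5] [cite: JetchevLauterStein2009, §3.6 (arXiv:0707.0032)] -/
theorem depthRow_5_neg8_149_print
    (h372 : GrossLMS1991.prop37_2_frobeniusCongruence)
    (K : Type) [Field K] [NumberField K] (hK : IsImaginaryQuadratic K)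
    (hD : NumberField.discr K = -8) :
    haveI := isElliptic_c643a1;
    haveI := isGloballyMinimal_c643a1;
    haveI : NeZero (((⟨1, 0, 0, -4, 3⟩ : WeierstrassCurve ℤ).map (Int.castRingHom ℚ)).conductorNorm ℤ) :=
      neZero_conductorNorm_of_isElliptic _;
    ∀ (Dt : ModularParametrizationData ((⟨1, 0, 0, -4, 3⟩ : WeierstrassCurve ℤ).map (Int.castRingHom ℚ))
        (((⟨1, 0, 0, -4, 3⟩ : WeierstrassCurve ℤ).map (Int.castRingHom ℚ)).conductorNorm ℤ)) (β : ℤ)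
      (ι : K →+* ℂ) (d : KolyvaginHeegnerData Dt β ι 149),
    d.kolyvaginClass (p := 5) (by norm_num) 1 ≠ 0 →
    ((⟨1, 0, 0, -4, 3⟩ : WeierstrassCurve ℤ).map (Int.castRingHom ℚ)).shaCorank 5 = 0 ∧
      ((⟨1, 0, 0, -4, 3⟩ : WeierstrassCurve ℤ).map (Int.castRingHom ℚ)).mordellWeilRank = 2 ∧
      (((⟨1, 0, 0, -4, 3⟩ : WeierstrassCurve ℤ).map (Int.castRingHom ℚ)).quadraticTwist
        ((-8 : ℤ) : ℚ)).mordellWeilRank ≤ 1 ∧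
      (∀ P : ((⟨1, 0, 0, -4, 3⟩ : WeierstrassCurve ℤ).map (Int.castRingHom ℚ)).toAffine.Point,
        5 • P = 0 → P = 0) ∧
      (∀ x ∈ ((⟨1, 0, 0, -4, 3⟩ : WeierstrassCurve ℤ).map (Int.castRingHom ℚ)).sha, 5 • x = 0 → x = 0) ∧
      Nat.card ↥(selmerGroup ((⟨1, 0, 0, -4, 3⟩ : WeierstrassCurve ℤ).map (Int.castRingHom ℚ))
        ((5 : ℕ) : ℤ)) = 5 ^ 2 := by
  haveI := isElliptic_c643a1
  haveI := isGloballyMinimal_c643a1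
  haveI : NeZero (((⟨1, 0, 0, -4, 3⟩ : WeierstrassCurve ℤ).map (Int.castRingHom ℚ)).conductorNorm ℤ) :=
    neZero_conductorNorm_of_isElliptic _
  intro Dt β ι d hne
  haveI := Fact.mk (by norm_num : Nat.Prime 5)
  exact depthRow_print_of_datum_of_intModel_certificate intModel h372 not_hasCM
    KernelCerts001.C643a1.two_le_rank 5 (by norm_num) hasSurjectiveModNGaloisRep_pow_5 K hK hD
    (by norm_num) (by norm_num) heegner_neg8 149 (by norm_num) (by norm_num) (by decide +kernel)
    (by norm_num) (by norm_num) (by norm_num) (by norm_num) (n := 135) card_149 (by norm_num)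
    (Δ₀ := -643) (by decide +kernel) (B := 11) (by decide +kernel) (by decide +kernel)
    (fun _ _ ↦ Or.inl (by norm_num)) Dt β ι d hne

end C643a1

namespace C655a1

/-- **DEPTH-TABLE ROW`655a1`, `(p, d_K, ℓ) = (7, -51, 83)`, ON PRINT-STANDARD INPUTS — no McCallum leaf,
no structure theorem, no twist point, no system (bit at ANY datum).** For `E = 655a1`, ANY imaginary
quadratic `K` with `d_K = -51`, any frame `(Dt, β, ι)` and ANY single Kolyvagin–Heegner datum `d` of
conductor `83`, granted the ONE Literature fact (γ) = `GrossLMS1991.prop37_2_frobeniusCongruence`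
(Gross 1991 Prop. 3.7 (2), the Eichler–Shimura congruence for Heegner points; cite-only): IF
`d.kolyvaginClass _ 1 ≠ 0` (the row's bit), THEN `corank_{ℤ_7} Ш(E)[7^∞] = 0`, `rank_ℤ E(ℚ) = 2`,
`rank_ℤ E^{(-51)}(ℚ) ≤ 1`, `E(ℚ)[7] = 0`, `Ш(E/ℚ)[7] = 0` and `#Sel^(7)(E/ℚ) = 7²` — the twin of
`C655a1.depthRow_7_neg51_83_ofDatum` with its FIVE named McCallum / Gross leaves (`h54 h43 h44 h53
h22`) DELETED: the sign law, Lemma 5.3 and Prop. 2.2 are tree theorems (`…LeafSign`,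
`…LeafEigenLine`, `…LeafReciprocity`), Lemma 4.3 is proved on the Kodaira–Néron cell / taken from F1
(`…LeafLocal`), Prop. 4.4 comes from (γ) (`JET.prop44_of_frobeniusCongruence`); the Kodaira–Néron
side condition (KN_7) `7 ∤ ord_v(Δ_min)` at the multiplicative places is CERTIFIED IN THE KERNEL
from `Δ(E₀) = -3275` (`decide`-able table of `depthRow_print_of_datum_of_intModel_certificate`), the
additive clause is void (`7 ≠ 3`). Every other side condition is a kernel theorem of the tree (g2–g7
certificates). CONDITIONAL on (γ) and the bit; per-curve; BSD is not proved by it. [cite: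
Kolyvagin1991MathAnn, Thm. 2.3] [cite: GrossLMS1991, Prop. 3.7 (2), §5 (5.1), Prop. 6.2 (1)] [cite:
McCallumLMS1991, §§2–5] [cite: JetchevLauterStein2009, §3.6 (arXiv:0707.0032)] -/
theorem depthRow_7_neg51_83_print
    (h372 : GrossLMS1991.prop37_2_frobeniusCongruence)
    (K : Type) [Field K] [NumberField K] (hK : IsImaginaryQuadratic K)
    (hD : NumberField.discr K = -51) :
    haveI := isElliptic_c655a1;
    haveI := isGloballyMinimal_c655a1;
    haveI : NeZero (((⟨0, 0, 1, -13, 18⟩ : WeierstrassCurve ℤ).map (Int.castRingHom ℚ)).conductorNorm ℤ) :=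
      neZero_conductorNorm_of_isElliptic _;
    ∀ (Dt : ModularParametrizationData ((⟨0, 0, 1, -13, 18⟩ : WeierstrassCurve ℤ).map (Int.castRingHom ℚ))
        (((⟨0, 0, 1, -13, 18⟩ : WeierstrassCurve ℤ).map (Int.castRingHom ℚ)).conductorNorm ℤ)) (β : ℤ)
      (ι : K →+* ℂ) (d : KolyvaginHeegnerData Dt β ι 83),
    d.kolyvaginClass (p := 7) (by norm_num) 1 ≠ 0 →
    ((⟨0, 0, 1, -13, 18⟩ : WeierstrassCurve ℤ).map (Int.castRingHom ℚ)).shaCorank 7 = 0 ∧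
      ((⟨0, 0, 1, -13, 18⟩ : WeierstrassCurve ℤ).map (Int.castRingHom ℚ)).mordellWeilRank = 2 ∧
      (((⟨0, 0, 1, -13, 18⟩ : WeierstrassCurve ℤ).map (Int.castRingHom ℚ)).quadraticTwist
        ((-51 : ℤ) : ℚ)).mordellWeilRank ≤ 1 ∧
      (∀ P : ((⟨0, 0, 1, -13, 18⟩ : WeierstrassCurve ℤ).map (Int.castRingHom ℚ)).toAffine.Point,
        7 • P = 0 → P = 0) ∧
      (∀ x ∈ ((⟨0, 0, 1, -13, 18⟩ : WeierstrassCurve ℤ).map (Int.castRingHom ℚ)).sha, 7 • x = 0 → x = 0) ∧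
      Nat.card ↥(selmerGroup ((⟨0, 0, 1, -13, 18⟩ : WeierstrassCurve ℤ).map (Int.castRingHom ℚ))
        ((7 : ℕ) : ℤ)) = 7 ^ 2 := by
  haveI := isElliptic_c655a1
  haveI := isGloballyMinimal_c655a1
  haveI : NeZero (((⟨0, 0, 1, -13, 18⟩ : WeierstrassCurve ℤ).map (Int.castRingHom ℚ)).conductorNorm ℤ) :=
    neZero_conductorNorm_of_isElliptic _
  intro Dt β ι d hne
  haveI := Fact.mk (by norm_num : Nat.Prime 7)
  exact depthRow_print_of_datum_of_intModel_certificate intModel h372 not_hasCM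
    KernelCerts001.C655a1.two_le_rank 7 (by norm_num) hasSurjectiveModNGaloisRep_pow_7 K hK hD
    (by norm_num) (by norm_num) heegner_neg51 83 (by norm_num) (by norm_num) (by decide +kernel)
    (by norm_num) (by norm_num) (by norm_num) (by norm_num) (n := 70) card_83 (by norm_num)
    (Δ₀ := -3275) (by decide +kernel) (B := 11) (by decide +kernel) (by decide +kernel)
    (fun _ _ ↦ Or.inl (by norm_num)) Dt β ι d hne

end C655a1

namespace C681c1

/-- **DEPTH-TABLE ROW`681c1`, `(p, d_K, ℓ) = (5, -83, 19)`, ON PRINT-STANDARD INPUTS — no McCallum leaf,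
no structure theorem, no twist point, no system (bit at ANY datum).** For `E = 681c1`, ANY imaginary
quadratic `K` with `d_K = -83`, any frame `(Dt, β, ι)` and ANY single Kolyvagin–Heegner datum `d` of
conductor `19`, granted the ONE Literature fact (γ) = `GrossLMS1991.prop37_2_frobeniusCongruence`
(Gross 1991 Prop. 3.7 (2), the Eichler–Shimura congruence for Heegner points; cite-only): IF
`d.kolyvaginClass _ 1 ≠ 0` (the row's bit), THEN `corank_{ℤ_5} Ш(E)[5^∞] = 0`, `rank_ℤ E(ℚ) = 2`,
`rank_ℤ E^{(-83)}(ℚ) ≤ 1`, `E(ℚ)[5] = 0`, `Ш(E/ℚ)[5] = 0` and `#Sel^(5)(E/ℚ) = 5²` — the twin of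
`C681c1.depthRow_5_neg83_19_ofDatum` with its FIVE named McCallum / Gross leaves (`h54 h43 h44 h53
h22`) DELETED: the sign law, Lemma 5.3 and Prop. 2.2 are tree theorems (`…LeafSign`,
`…LeafEigenLine`, `…LeafReciprocity`), Lemma 4.3 is proved on the Kodaira–Néron cell / taken from F1
(`…LeafLocal`), Prop. 4.4 comes from (γ) (`JET.prop44_of_frobeniusCongruence`); the Kodaira–Néron
side condition (KN_5) `5 ∤ ord_v(Δ_min)` at the multiplicative places is CERTIFIED IN THE KERNEL
from `Δ(E₀) = -2043` (`decide`-able table of `depthRow_print_of_datum_of_intModel_certificate`), the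
additive clause is void (`5 ≠ 3`). Every other side condition is a kernel theorem of the tree (g2–g7
certificates). CONDITIONAL on (γ) and the bit; per-curve; BSD is not proved by it. [cite:
Kolyvagin1991MathAnn, Thm. 2.3] [cite: GrossLMS1991, Prop. 3.7 (2), §5 (5.1), Prop. 6.2 (1)] [cite:
McCallumLMS1991, §§2–5] [cite: JetchevLauterStein2009, §3.6 (arXiv:0707.0032)] -/
theorem depthRow_5_neg83_19_print
    (h372 : GrossLMS1991.prop37_2_frobeniusCongruence)
    (K : Type) [Field K] [NumberField K] (hK : IsImaginaryQuadratic K)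
    (hD : NumberField.discr K = -83) :
    haveI := isElliptic_c681c1;
    haveI := isGloballyMinimal_c681c1;
    haveI : NeZero (((⟨0, -1, 1, 0, 2⟩ : WeierstrassCurve ℤ).map (Int.castRingHom ℚ)).conductorNorm ℤ) :=
      neZero_conductorNorm_of_isElliptic _;
    ∀ (Dt : ModularParametrizationData ((⟨0, -1, 1, 0, 2⟩ : WeierstrassCurve ℤ).map (Int.castRingHom ℚ))
        (((⟨0, -1, 1, 0, 2⟩ : WeierstrassCurve ℤ).map (Int.castRingHom ℚ)).conductorNorm ℤ)) (β : ℤ)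
      (ι : K →+* ℂ) (d : KolyvaginHeegnerData Dt β ι 19),
    d.kolyvaginClass (p := 5) (by norm_num) 1 ≠ 0 →
    ((⟨0, -1, 1, 0, 2⟩ : WeierstrassCurve ℤ).map (Int.castRingHom ℚ)).shaCorank 5 = 0 ∧
      ((⟨0, -1, 1, 0, 2⟩ : WeierstrassCurve ℤ).map (Int.castRingHom ℚ)).mordellWeilRank = 2 ∧
      (((⟨0, -1, 1, 0, 2⟩ : WeierstrassCurve ℤ).map (Int.castRingHom ℚ)).quadraticTwist
        ((-83 : ℤ) : ℚ)).mordellWeilRank ≤ 1 ∧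
      (∀ P : ((⟨0, -1, 1, 0, 2⟩ : WeierstrassCurve ℤ).map (Int.castRingHom ℚ)).toAffine.Point,
        5 • P = 0 → P = 0) ∧
      (∀ x ∈ ((⟨0, -1, 1, 0, 2⟩ : WeierstrassCurve ℤ).map (Int.castRingHom ℚ)).sha, 5 • x = 0 → x = 0) ∧
      Nat.card ↥(selmerGroup ((⟨0, -1, 1, 0, 2⟩ : WeierstrassCurve ℤ).map (Int.castRingHom ℚ))
        ((5 : ℕ) : ℤ)) = 5 ^ 2 := by
  haveI := isElliptic_c681c1
  haveI := isGloballyMinimal_c681c1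
  haveI : NeZero (((⟨0, -1, 1, 0, 2⟩ : WeierstrassCurve ℤ).map (Int.castRingHom ℚ)).conductorNorm ℤ) :=
    neZero_conductorNorm_of_isElliptic _
  intro Dt β ι d hne
  haveI := Fact.mk (by norm_num : Nat.Prime 5)
  exact depthRow_print_of_datum_of_intModel_certificate intModel h372 not_hasCM
    KernelCerts002.C681c1.two_le_rank 5 (by norm_num) hasSurjectiveModNGaloisRep_pow_5 K hK hD
    (by norm_num) (by norm_num) heegner_neg83 19 (by norm_num) (by norm_num) (by decide +kernel)
    (by norm_num) (by norm_num) (by norm_num) (by norm_num) (n := 25) card_19 (by norm_num)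
    (Δ₀ := -2043) (by decide +kernel) (B := 11) (by decide +kernel) (by decide +kernel)
    (fun _ _ ↦ Or.inl (by norm_num)) Dt β ι d hne

end C681c1

end Summit.BirchSwinnertonDyer.BirchSwinnertonDyer.Theorems.KolyvaginDepthDoor

end
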